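import Literature.MathematicalPhysics.QuantumLattice.HubbardTTPrimeThermalPhaseCoexistenceCanonicalSuperSegment
import Literature.MathematicalPhysics.QuantumLattice.TorusSectorGibbsMixture
import HarnessLib

/-!
# Thermal phase separation in the canonical ensemble, HOT-ANCHORED energy-window form: a certified pressure CEILING at a
# hotter inverse temperature `β_h` (at each outer density) replaces the a-priori entropy allowance `2·H_b(n/2) ≤ log 4` of the
# energy-window form; threshold `β₀ = [a π₁ + b π₂ + β_{h,1} a f₁ + β_{h,2} b f₂]/M` in place of `2 log 2 / M`

Topic `Literature/MathematicalPhysics/QuantumLattice` (family `hubbard`); sequel of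
`HubbardTTPrimeThermalPhaseCoexistenceCanonicalSuperSegment` (§ energy-window form: a ground-state energy CAP `c` at the mean density
`a n₁ + b n₂` and FLOORS `f₁, f₂` at `n₁, n₂` with margin `M = a f₁ + b f₂ − c > 0` exclude the `(≤ n₁ | ≥ n₂)` coexistence in every
canonical thermal torus-limit state for `β > 2 log 2 / M`, using the a-priori pressure window `−βe ≤ p(β;·) ≤ 2H_b(·/2) − βe`). The only
loose ingredient there is the pressure CAP at the two outer densities, `p(β; n_i) ≤ 2H_b(n_i/2) − β e(n_i)` — the infinite-temperature
value of the free entropy. THIS FILE replaces it by any certified HOT ANCHOR: a ceiling `p(β_h; n_i) ≤ π_i` at some `0 ≤ β_h ≤ β`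
(e.g. a Markov / cluster free-energy certificate, `MarkovCertificatePressureCeiling`: ONE grand-canonical certificate at `(β_h, μ)` caps
`p(β_h; n′) ≤ m − β_h μ n′` at EVERY density `n′` — the Legendre transfer across the filling axis), carried to `β` by the convexity /
staircase step `p(β; n) ≤ p(β_h; n) − (β − β_h)·f` for a ground-state floor `f ≤ e(n)` (`pressureTT'_le_pressureTT'_sub_mul` with the
variational inequality `e(n) ≤ e_Φ(ω)` of every canonical thermal torus limit, `energyDensityTT'_le_meanEnergy_of_sectorGibbs`).
PROVED (`U ≥ 0`, `0 ≤ n₁ < n₂ < 2`, `a, b ≥ 0`, `a + b = 1`):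
* `ThermodynamicLimit.pressureTT'_le_hotCeiling_sub_mul_of_floor` — `p(β; n) ≤ π − (β − β_h)·f` for `0 ≤ β_h ≤ β`, `p(β_h; n) ≤ π`,
  `f ≤ e(n)`;
* `InfVolFermionState.not_isTorusLimitOfMixture_mix_of_hotAnchors_of_le` — cap `e(a n₁ + b n₂) ≤ c`, floors `f_i ≤ e(n_i)`, anchors
  `p(β_{h,i}; n_i) ≤ π_i` (`0 ≤ β_{h,i} ≤ β`) and `a π₁ + b π₂ + β_{h,1}·a f₁ + β_{h,2}·b f₂ < β·(a f₁ + b f₂ − c)` exclude the coexistence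
  in every canonical thermal state at `(β; t, t', U; n)`, every `0 < n < 2`;
* `…_of_hotAnchor_right_of_le` — anchor at `n₂` only, the dilute partner `n₁` keeps the `β_h = 0` anchor `π₁ = 2H_b(n₁/2)`
  (`pressureTT'_zero`): condition `a·2H_b(n₁/2) + b π₂ + β_h·b f₂ < β·M`;
* `…_of_hotAnchors_of_threshold_le` — the monotone form: `0 ≤ M`, `a π₁ + b π₂ + β_{h,1} a f₁ + β_{h,2} b f₂ < β₀·M` and `β₀ ≤ β`
  (`β_{h,i} ≤ β₀`) ⇒ excluded at `β` (how instances state «for every `β ≥ β₀`»).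
The `β_h = 0` anchors `π_i = 2H_b(n_i/2)` recover the energy-window form exactly.
HONEST SCOPE: exclusion of MACROSCOPIC coexistence (mixtures of translation-invariant states) in canonical thermal torus-limit states;
nothing about stripes / finite-period states, about which phase is realised, or about `T = 0`; the anchors are inputs (claim nodes or
kernel theorems of the instance files), nothing is certified here. Everything is PROVED; no definition, no named fact, no number.
Written 2026-08-28 by hubbard-downfold-unc-2 (g20; cell `pub/hubbard-downfold`, MO-S1 ↔ S2 seam, filling direction) for the `T > 0` cells of
the material-box phase-separation words (`Summits/…/Observables/PhaseSeparationExclusionBoxThermal{,HotAnchor}.lean`).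

## Mathlib / tree search
REUSED: `not_isTorusLimitOfMixture_mix_of_caps_lt_floor_of_le` (`…CanonicalSuperSegment`), `pressureTT'_mem_Icc`, `pressureTT'_zero`,
`pressureTT'_le_pressureTT'_sub_mul` (`HubbardTTPrimeThermalPressureLimit`), `IsTorusLimitOfMixture.energyDensityTT'_le_meanEnergy_of_sectorGibbs`
(`TorusSectorGibbsMixture`). `lean search 'hotAnchor|hotCeiling_sub'`: no hit (2026-08-28); the hot-anchor chords of the thermal crews
(`meanEnergy_hubbardTTPrime_le_chord_of_pressureCeiling_of_pressureFloor`) bound the ENERGY, not the pressure at another density.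

## References
* R. B. Israel, *Convexity in the Theory of Lattice Gases* (1979), Thm. I.2.4, §III. [cite: Israel1979, Thm. I.2.4]
* S. Gustafson, I. M. Sigal, *Mathematical Concepts of Quantum Mechanics* (2003), §18.3 (convexity of `log Z` in `β`). [cite: GustafsonSigal2003, §18.3]
* D. Poulin, M. B. Hastings, Phys. Rev. Lett. 106 (2011) 080403, eqs. (3)–(8) (Markov free-energy certificates). [cite: PoulinHastings2011, eqs. (3)–(8)]
* V. J. Emery, S. A. Kivelson, H. Q. Lin, Phys. Rev. Lett. 64 (1990) 475. [cite: EmeryKivelsonLin1990, pp. 475–476]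
* D. Ruelle, *Statistical Mechanics: Rigorous Results* (1969), §3.3–§3.4. [cite: Ruelle1969, §3.3]
-/

noncomputable section

open scoped ComplexOrder BigOperators
open Filter Topology Finset Set

namespace Literature.MathematicalPhysics.QuantumLattice

open Matrix HubbardWave0 Literature.Probability.LatticeModels ThermodynamicLimit

namespace ThermodynamicLimit

/-- **Hot anchor ⇒ pressure cap at every colder temperature.** For `U ≥ 0`, `0 ≤ n < 2`, `0 ≤ β_h ≤ β`: a ceiling
`p(β_h; t,t',U; n) ≤ π` and a ground-state energy floor `f ≤ e(t,t',U,n)` give `p(β; t,t',U; n) ≤ π − (β − β_h)·f` — the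
staircase ceiling step `p(β) ≤ p(β_h) − (β − β_h)·e⁻` with the variational floor `e(n) ≤ e_Φ(ω)` of every canonical thermal torus limit
at `β`. [cite: GustafsonSigal2003, §18.3] [cite: Ruelle1969, §3.4] -/
theorem pressureTT'_le_hotCeiling_sub_mul_of_floor (t t' : ℝ) {U : ℝ} (hU : 0 ≤ U) {n : ℝ} (hn0 : 0 ≤ n)
    (hn2 : n < 2) {βh β : ℝ} (hβh : 0 ≤ βh) (hβ : βh ≤ β) {π f : ℝ} (hπ : pressureTT' βh t t' U n ≤ π)
    (hf : f ≤ energyDensityTT' t t' U n) :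
    pressureTT' β t t' U n ≤ π - (β - βh) * f := by
  have hstep : pressureTT' β t t' U n ≤ pressureTT' βh t t' U n - (β - βh) * f :=
    pressureTT'_le_pressureTT'_sub_mul hn0 hn2 t t' hU hβh hβ
      (fun ω Ls hLs hω => hf.trans (hω.energyDensityTT'_le_meanEnergy_of_sectorGibbs t t' U hn0 hn2 β hLs t' hU))
  linarith

/-- **The `β_h = 0` anchor is the a-priori one**: `p(0; t,t',U; n) ≤ 2·H_b(n/2)` (in fact equality, `pressureTT'_zero`).
[cite: Israel1979, Thm. I.2.4] -/
theorem pressureTT'_zero_le_two_mul_binEntropy (t t' : ℝ) {U : ℝ} (hU : 0 ≤ U) {n : ℝ} (hn0 : 0 ≤ n) (hn2 : n < 2) :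
    pressureTT' 0 t t' U n ≤ 2 * Real.binEntropy (n / 2) :=
  (pressureTT'_zero t t' hU hn0 hn2).le

end ThermodynamicLimit

namespace InfVolFermionState

variable (t t' : ℝ) {U : ℝ} (hU : 0 ≤ U) {β : ℝ} (hβ : 0 < β) {ω₁ ω₂ : InfVolFermionState 2} {Ls : ℕ → ℕ} {n : ℝ}
include hU hβ

/-- **Hot-anchored energy-window form.** `0 ≤ n₁ < n₂ < 2`, translation-invariant `ω₁, ω₂` with
`0 < ρ(ω₁) ≤ n₁`, `n₂ ≤ ρ(ω₂) < 2`, weights `a, b ≥ 0`, `a + b = 1`; a ground-state energy CAP `e(a n₁ + b n₂) ≤ c`, FLOORS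
`f₁ ≤ e(n₁)`, `f₂ ≤ e(n₂)`; pressure ceilings `p(β_{h,1}; n₁) ≤ π₁`, `p(β_{h,2}; n₂) ≤ π₂` at hotter `0 ≤ β_{h,i} ≤ β`; and
`a π₁ + b π₂ + β_{h,1}·(a f₁) + β_{h,2}·(b f₂) < β·(a f₁ + b f₂ − c)`. Then NO canonical thermal torus-limit state at
`(β; t,t',U; n)` (`0 < n < 2`) is the mixture `λω₁ + (1−λ)ω₂` (`0 < λ < 1`): the outer pressures are capped by
`π_i − (β − β_{h,i}) f_i`, the mean-density pressure is floored by `−β c`, and the hypothesis is exactly `a Q₁ + b Q₂ < W`.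
[cite: Israel1979, Thm. I.2.4] [cite: PoulinHastings2011, eqs. (3)–(8)] -/
theorem not_isTorusLimitOfMixture_mix_of_hotAnchors_of_le (h₁ : ω₁.IsTranslationInvariant)
    (h₂ : ω₂.IsTranslationInvariant) (hρ₁0 : 0 < ω₁.density) (hρ₂2 : ω₂.density < 2)
    {n₁ n₂ : ℝ} (hn₁0 : 0 ≤ n₁) (hn₂2 : n₂ < 2) (hn₁ : ω₁.density ≤ n₁) (hn12 : n₁ < n₂) (hn₂ : n₂ ≤ ω₂.density)
    {a b : ℝ} (ha : 0 ≤ a) (hb : 0 ≤ b) (hab : a + b = 1) {c f₁ f₂ : ℝ}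
    (hcap : energyDensityTT' t t' U (a * n₁ + b * n₂) ≤ c)
    (hf₁ : f₁ ≤ energyDensityTT' t t' U n₁) (hf₂ : f₂ ≤ energyDensityTT' t t' U n₂)
    {βh₁ βh₂ π₁ π₂ : ℝ} (hβh₁ : 0 ≤ βh₁) (hβh₂ : 0 ≤ βh₂) (hle₁ : βh₁ ≤ β) (hle₂ : βh₂ ≤ β)
    (hπ₁ : pressureTT' βh₁ t t' U n₁ ≤ π₁) (hπ₂ : pressureTT' βh₂ t t' U n₂ ≤ π₂)
    (hM : a * π₁ + b * π₂ + βh₁ * (a * f₁) + βh₂ * (b * f₂) < β * (a * f₁ + b * f₂ - c))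
    (hn0 : 0 < n) (hn2 : n < 2) {lam : ℝ} (hl0 : 0 < lam) (hl1 : lam < 1) (hLs : Tendsto Ls atTop atTop) :
    ¬ (mix lam hl0.le hl1.le ω₁ ω₂).IsTorusLimitOfMixture (sectorGibbsCount n) (fun L => sectorGibbsWeightTT' β t t' U n L)
      (fun L => sectorGibbsVectorTT' t t' U n L) Ls := by
  have hn₁2 : n₁ < 2 := by linarith
  have hn₂0 : 0 ≤ n₂ := by linarith
  have hm0 : 0 ≤ a * n₁ + b * n₂ := by positivity
  have hm2 : a * n₁ + b * n₂ < 2 := by nlinarith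
  -- pressure floor at the mean density (zero-entropy line) and hot-anchored caps at the outer densities
  have hW := (pressureTT'_mem_Icc hβ.le t t' hU hm0 hm2).1
  have hQ₁ := pressureTT'_le_hotCeiling_sub_mul_of_floor t t' hU hn₁0 hn₁2 hβh₁ hle₁ hπ₁ hf₁
  have hQ₂ := pressureTT'_le_hotCeiling_sub_mul_of_floor t t' hU hn₂0 hn₂2 hβh₂ hle₂ hπ₂ hf₂
  refine not_isTorusLimitOfMixture_mix_of_caps_lt_floor_of_le t t' hU hβ h₁ h₂ hρ₁0 hρ₂2 hn₁ hn12 hn₂ ha hb hab hW hQ₁ hQ₂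
    ?_ hn0 hn2 hl0 hl1 hLs
  have k3 := mul_le_mul_of_nonneg_left hcap hβ.le
  have e : a * (π₁ - (β - βh₁) * f₁) + b * (π₂ - (β - βh₂) * f₂) =
      a * π₁ + b * π₂ + βh₁ * (a * f₁) + βh₂ * (b * f₂) - β * (a * f₁ + b * f₂) := by ring
  rw [e]
  linarith

/-- **Hot anchor at the dense partner only.** As `…_of_hotAnchors_of_le` with the `β_h = 0` anchor `2·H_b(n₁/2)` at `n₁`
(`pressureTT'_zero`): condition `a·(2 H_b(n₁/2)) + b π₂ + β_h·(b f₂) < β·(a f₁ + b f₂ − c)` (`0 ≤ β_h ≤ β`, `p(β_h; n₂) ≤ π₂`).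
The form used for a DILUTE partner `n₁`, whose infinite-temperature entropy `2H_b(n₁/2)` is already small.
[cite: Israel1979, Thm. I.2.4] [cite: PoulinHastings2011, eqs. (3)–(8)] -/
theorem not_isTorusLimitOfMixture_mix_of_hotAnchor_right_of_le (h₁ : ω₁.IsTranslationInvariant)
    (h₂ : ω₂.IsTranslationInvariant) (hρ₁0 : 0 < ω₁.density) (hρ₂2 : ω₂.density < 2)
    {n₁ n₂ : ℝ} (hn₁0 : 0 ≤ n₁) (hn₂2 : n₂ < 2) (hn₁ : ω₁.density ≤ n₁) (hn12 : n₁ < n₂) (hn₂ : n₂ ≤ ω₂.density)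
    {a b : ℝ} (ha : 0 ≤ a) (hb : 0 ≤ b) (hab : a + b = 1) {c f₁ f₂ : ℝ}
    (hcap : energyDensityTT' t t' U (a * n₁ + b * n₂) ≤ c)
    (hf₁ : f₁ ≤ energyDensityTT' t t' U n₁) (hf₂ : f₂ ≤ energyDensityTT' t t' U n₂)
    {βh π₂ : ℝ} (hβh : 0 ≤ βh) (hle : βh ≤ β) (hπ₂ : pressureTT' βh t t' U n₂ ≤ π₂)
    (hM : a * (2 * Real.binEntropy (n₁ / 2)) + b * π₂ + βh * (b * f₂) < β * (a * f₁ + b * f₂ - c))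
    (hn0 : 0 < n) (hn2 : n < 2) {lam : ℝ} (hl0 : 0 < lam) (hl1 : lam < 1) (hLs : Tendsto Ls atTop atTop) :
    ¬ (mix lam hl0.le hl1.le ω₁ ω₂).IsTorusLimitOfMixture (sectorGibbsCount n) (fun L => sectorGibbsWeightTT' β t t' U n L)
      (fun L => sectorGibbsVectorTT' t t' U n L) Ls := by
  have hn₁2 : n₁ < 2 := by linarith
  refine not_isTorusLimitOfMixture_mix_of_hotAnchors_of_le t t' hU hβ h₁ h₂ hρ₁0 hρ₂2 hn₁0 hn₂2 hn₁ hn12 hn₂ ha hb hab hcap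
    hf₁ hf₂ le_rfl hβh hβ.le hle (pressureTT'_zero_le_two_mul_binEntropy t t' hU hn₁0 hn₁2) hπ₂ ?_ hn0 hn2 hl0 hl1 hLs
  simpa using hM

/-- **Threshold (monotone) form.** With `M := a f₁ + b f₂ − c ≥ 0`: if `a π₁ + b π₂ + β_{h,1} a f₁ + β_{h,2} b f₂ < β₀·M` for some
`β₀ ≥ β_{h,1}, β_{h,2}`, then the coexistence is excluded at EVERY `β ≥ β₀` (`β₀·M ≤ β·M`). This is how instances state
«for every `β ≥ β₀`» with one rational check. [cite: Israel1979, Thm. I.2.4] [cite: PoulinHastings2011, eqs. (3)–(8)] -/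
theorem not_isTorusLimitOfMixture_mix_of_hotAnchors_of_threshold_le (h₁ : ω₁.IsTranslationInvariant)
    (h₂ : ω₂.IsTranslationInvariant) (hρ₁0 : 0 < ω₁.density) (hρ₂2 : ω₂.density < 2)
    {n₁ n₂ : ℝ} (hn₁0 : 0 ≤ n₁) (hn₂2 : n₂ < 2) (hn₁ : ω₁.density ≤ n₁) (hn12 : n₁ < n₂) (hn₂ : n₂ ≤ ω₂.density)
    {a b : ℝ} (ha : 0 ≤ a) (hb : 0 ≤ b) (hab : a + b = 1) {c f₁ f₂ : ℝ}
    (hcap : energyDensityTT' t t' U (a * n₁ + b * n₂) ≤ c)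
    (hf₁ : f₁ ≤ energyDensityTT' t t' U n₁) (hf₂ : f₂ ≤ energyDensityTT' t t' U n₂)
    {βh₁ βh₂ π₁ π₂ β₀ : ℝ} (hβh₁ : 0 ≤ βh₁) (hβh₂ : 0 ≤ βh₂) (h0₁ : βh₁ ≤ β₀) (h0₂ : βh₂ ≤ β₀) (hβ₀ : β₀ ≤ β)
    (hπ₁ : pressureTT' βh₁ t t' U n₁ ≤ π₁) (hπ₂ : pressureTT' βh₂ t t' U n₂ ≤ π₂)
    (hMnn : 0 ≤ a * f₁ + b * f₂ - c)
    (hM₀ : a * π₁ + b * π₂ + βh₁ * (a * f₁) + βh₂ * (b * f₂) < β₀ * (a * f₁ + b * f₂ - c))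
    (hn0 : 0 < n) (hn2 : n < 2) {lam : ℝ} (hl0 : 0 < lam) (hl1 : lam < 1) (hLs : Tendsto Ls atTop atTop) :
    ¬ (mix lam hl0.le hl1.le ω₁ ω₂).IsTorusLimitOfMixture (sectorGibbsCount n) (fun L => sectorGibbsWeightTT' β t t' U n L)
      (fun L => sectorGibbsVectorTT' t t' U n L) Ls := by
  have k := mul_le_mul_of_nonneg_right hβ₀ hMnn
  exact not_isTorusLimitOfMixture_mix_of_hotAnchors_of_le t t' hU hβ h₁ h₂ hρ₁0 hρ₂2 hn₁0 hn₂2 hn₁ hn12 hn₂ ha hb hab hcap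
    hf₁ hf₂ hβh₁ hβh₂ (h0₁.trans hβ₀) (h0₂.trans hβ₀) hπ₁ hπ₂ (hM₀.trans_le k) hn0 hn2 hl0 hl1 hLs

end InfVolFermionState

end Literature.MathematicalPhysics.QuantumLattice
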